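import Summits.QuantumFields.YangMills.Theorems.UnitScaleTiltFluctuationComparisonRegPrGlobalSlackLocalToGlobalOn
import Summits.QuantumFields.YangMills.Theorems.UnitScaleTiltFluctuationComparisonRegPrGlobalSlackCanonicalEndToEnd
import Summits.QuantumFields.YangMills.Theorems.UnitScaleTiltFluctuationComparisonRegPrPrintChiSlack
import Summits.QuantumFields.YangMills.Theorems.UnitScaleTiltFluctuationComparisonRegPrGlobalSlackOn
import Summits.QuantumFields.YangMills.Theorems.UnitScaleTiltInteriorExcisionInner
import HarnessLib

/-!
# `UnitScaleTiltFluctuationComparisonRegPrGlobalSlackCanonicalOnChi` — STUB (i)* OF v5k FROM THE SIX CHART ROWS READ ON PRINT'S χ, BY NAME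
# (crux `FluctuationComparisonRegPrIntL`, stmt-QuantumFields-20520 — interior re-typing (E-INT) of `FluctuationComparisonRegPrL`, stmt-QuantumFields-19935 — registered
# skeleton `Cruxes/FluctuationComparisonRegPrIntL/Lines/birth_v5k.lean` 3b016214180ca501, STUB (i)* `stub_smallBlocksSlackOnChiAll` (odd `L < 7`, every margin `μ ∈ (0,1)`);
# width-lever lane B «(R1) print's characteristic function χ of [Balaban1985UV3] (47) back — re-derive the small-block case structurally, no numerics», seat ym-ust-19935-r1 g2)

THE POINT.  Lane A's capstone (`…GlobalSlackCanonicalEndToEnd`, p538799) reads the large-block stub 3⁗ (`7 ≤ L`) BY NAME from the six chart rows of the K1a interface at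
the canonical polymerisation (`K1aChartRows L 𝔠 a₀ a₁ a`).  The small-block stub (i)* of the re-typed item differs from 3⁗ in exactly two tokens: `7 ≤ L ↦ 1 < L → L < 7 →
∀ μ ∈ (0,1)` and `GlobalSupRateTSlack D ↦ ∀ ε₀ ∈ (0, a₀], PrintChi.GlobalSupRateTSlackOn (ChiGood … ε₀ μ) D` — King's slack row is asked only at data whose regular
minimiser is history-good with margin `μ` for BOTH runs (print's `χ_k` of (47) p.267, typed by ★r1 g0 as `PrintChi.ChiGood`, p528527).  Of the six chart rows only three read
the datum `V` — `RemainderSmallΦ`, `CfgSizeΦ`, `CfgCauchyΦ` (the background configuration of `V` in chart coordinates: its size (28)/(44), its two-run Cauchy property, the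
Taylor rest at it) — and these are precisely the rows that the sharp window's edge band defeats at `L ∈ {3,5}` (FINDING #44/#56: `κ_min(3)√3 = 1.66`, the background of an
edge datum leaves the next window) and that print never asks off `χ_k`.  So:

* §1 **`K1aChartRowsOnChi L μ 𝔠 a₀ a₁ a`** — `K1aChartRows` VERBATIM except that the three configuration-dependent rows are asked, for every `0 < ε₀ ≤ a₀`, only at
  doubly-χ-good data (`…On (χ ε₀ μ)` of `…GlobalSlackKernelMatchingOn`), the chart carriers being allowed to depend on `ε₀`; `k1aChartRowsOnChi_of_chartRows` (the
  full-window rows imply the χ-rows at every margin);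
* §2 **`smallBlocksSlackOnChiAll_of_k1aChartRowsOnChi`** : `(∀ odd L, 1 < L < 7, ∀ μ ∈ (0,1), ∀ 𝔠 a₀ a₁ …, ∃ a ∈ (0,1), K1aChartRowsOnChi L μ 𝔠 a₀ a₁ a) →`
  ⟨THE REGISTERED TEXT OF `stub_smallBlocksSlackOnChiAll` VERBATIM⟩ — threshold `γB ⊓ gammaW ⊓ e^{2(1−p₀)}`, `π := canonPolymer p`, `σ := 7`, and the `ε₀`-UNIFORM constant
  `max(C′,0)·(C_T + C₁/(1 − L^{a−1}) + C₁/(1 − L⁻¹))` of the producer (it reads the constants, not `χ`); the five producer rows are lane A's theorems for the canonical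
  polymerisation (`pintDecompTrivT_canon`, `locCover_canon`, `locBlockVolume_canon`, `locMatched_canon`, `termSizeTrivT_canon`), the three coupling windows follow from `γ`
  small (`window_sum_le_one`, `window_jet`, `window_oldSlice`);
* §4 `innerAll_of_laneRecords_k1aChartRowsOnChi` : 2′ ∧ (χ-rows at EVERY odd `L > 1`, every margin) ⟹ the inner body at `μ_L = 1 − 2/(L√L)` for every odd `L > 1`
  (★r1 g0's per-`L` inner socket p538550) — the `hInner` of ★p2 g14's `InteriorExcision.regPrIntL_of_innerChi`; the composition to the route decl (v5k with BOTH analytic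
  stubs 3⁗ and (i)* replaced by the one χ-hypothesis, no `7 ≤ L` anywhere) is the route-cone sibling `…GlobalSlackCanonicalOnChiIntL`;
* §3 `smallBlocksSlackOnChiAll_of_k1aChartRows` — the corollary: lane A's FULL-window rows at `L ∈ {3,5}` would give (i)* outright (sanity / the «if 3⁗'s producers run at
  every L» reading); and the two `Iff.rfl` bridges `GlobalSupRateWSlackOn S D b₀ p₀ (θ²) ↔ PrintChi.GlobalSupRateTSlackOn S D ↔ GlobalSlackOn.GlobalSupRateTSlackOn D S`.

UPSHOT FOR v5k: the two analytic stubs 3⁗ (`L ≥ 7`) and (i)* (`L < 7`) now read ONE producer interface — the six chart rows at `dataOfV3 p (canonPolymer p)` / `canonPT p` —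
the large-block one on the whole sharp window, the small-block one with the three configuration rows restricted to print's χ.  Hypothesis schemas only; nothing of
[Balaban1985UV3]/[King1986] is asserted; no numerics; registry untouched (`--supports stmt-QuantumFields-20520`).

References: T. Bałaban, CMP 102 (1985) 255–275 [Balaban1985UV3] ((7) p.257, (25) p.262, (28)–(30) p.263, (33)–(34) p.264, (43)–(46) pp.266–267, (47) p.267, (57) p.270);
C. King, CMP 102 (1986) 649–677 [King1986] (Thm 3.4 (3.9) p.656, Prop. 3.6 (3.56) p.662, Props. 3.8–3.9 pp.664–665).
-/

set_option autoImplicit false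

noncomputable section

namespace Summit.QuantumFields.YangMills.Theorems.GlobalSlackCanonicalOnChi

open scoped BigOperators
open MeasureTheory Filter
open Literature.MathematicalPhysics.QuantumFieldTheory.Balaban1983to89
open Literature.MathematicalPhysics.QuantumFieldTheory.Balaban1983to89.T3ContinuumYM3Torus
open Literature.MathematicalPhysics.QuantumFieldTheory.Balaban1983to89.T3UnitLawDensityEML (ℰp measurableE_ℰp)
open Literature.MathematicalPhysics.QuantumFieldTheory.Balaban1983to89.T3UnitScaleTilt
open Literature.MathematicalPhysics.QuantumFieldTheory.Balaban1983to89.T3TiltDescent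
open Literature.MathematicalPhysics.QuantumFieldTheory.Balaban1983to89.T3PrintedRegularMinimiser
open Literature.MathematicalPhysics.QuantumFieldTheory.Balaban1983to89.T3LogComparisonSocket
open Literature.MathematicalPhysics.QuantumFieldTheory.Balaban1983to89.T3SmallLiftHistory
open Literature.MathematicalPhysics.QuantumFieldTheory.Balaban1983to89.T3AlphaInputsAC
open Literature.MathematicalPhysics.QuantumFieldTheory.Balaban1983to89.T3AlphaInputsACTwoRun
open Literature.MathematicalPhysics.QuantumFieldTheory.Balaban1983to89.T3AlphaInputsACTwoRunLevel
open Literature.MathematicalPhysics.QuantumFieldTheory.Balaban1983to89.B12TreeDecay (kappa₀ K₀ K₀_pos)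
open Literature.MathematicalPhysics.QuantumFieldTheory.Balaban1985CMP102
open Literature.MathematicalPhysics.QuantumFieldTheory.Balaban1985CMP102.Setting
open Summit.QuantumFields.Balaban3D.Carriers
open Summit.QuantumFields.Balaban3D.Proofs.Primitives
open Summit.QuantumFields.Balaban3D.Proofs.GroupModelLieC (lieC)
open Summit.QuantumFields.YangMills.Theorems
open Summit.QuantumFields.YangMills.Theorems.GlobalSlackKernelMatching
open Summit.QuantumFields.YangMills.Theorems.GlobalSlackKernelMatchingOn
open Summit.QuantumFields.YangMills.Theorems.GlobalSlackLocalToGlobalOn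
open Summit.QuantumFields.YangMills.Theorems.GlobalSlackCanonicalPolymers

/-! ## §0 The registered currency is the `θ(n)²`-instance of the generic row on `S` -/

section Bridges

variable {F : T3Family} {γ : ℝ} (S : WinPred F) (D : AlphaDataT3 F γ) (b₀ p₀ a : ℝ) (σ : ℕ) (C : ℝ)

/-- The registered (i)* currency `PrintChi.GlobalSupRateTSlackOn S D` IS the `w n = θ(n)²` instance of `GlobalSupRateWSlackOn S D` (definitional). [cite: King1986, Thm 3.4 (3.9) p.656] -/
theorem printChi_globalSupRateTSlackOn_iff_W :
    PrintChi.GlobalSupRateTSlackOn S D b₀ p₀ a σ C ↔ GlobalSupRateWSlackOn S D b₀ p₀ (fun n => θBal F.L γ b₀ p₀ n ^ 2) a σ C :=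
  Iff.rfl

/-- ★r1's `PrintChi.GlobalSupRateTSlackOn S D` and ★p2's `GlobalSlackOn.GlobalSupRateTSlackOn D S` (p533710) carry the SAME text (definitional; dedup note for consumers).
[cite: King1986, Thm 3.4 (3.9) p.656] -/
theorem printChi_globalSupRateTSlackOn_iff_globalSlackOn :
    PrintChi.GlobalSupRateTSlackOn S D b₀ p₀ a σ C ↔ GlobalSlackOn.GlobalSupRateTSlackOn D S b₀ p₀ a σ C :=
  Iff.rfl

end Bridges

/-! ## §1 The six chart rows at the canonical polymerisation, the three configuration rows read on print's χ -/

/-- **THE K1a CHART ROWS ON χ-GOOD DATA** (hypothesis schema, never asserted) — lane A's `K1aChartRows L 𝔠 a₀ a₁ a` with ONE change: the three configuration-dependent rows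
`RemainderSmallΦ`/`CfgSizeΦ`/`CfgCauchyΦ (ℓ ≡ 1)` are asked, for every regularity threshold `0 < ε₀ ≤ a₀`, only at window data that are χ-good with margin `μ` for BOTH
runs (`PrintChi.ChiGood F γ b₀ p₀ ε₀ μ`: the regular minimiser of the datum is history-good with margin `μ` at every height strictly below it — print's `χ_k` of (47));
the located letters `0 < κ ≤ 𝔠.κ`, `κ₀(32,6) ≤ κ`, `L ≤ M₁`, the constants, the threshold, the coherent family `p` with the given [7]-constants and the three
configuration-free rows (`TaylorSplitΦ (canonPT p)`, K1a `FlatKernelCauchyΦ`, `KernelSizeΦ` at `dataOfV3 p (canonPolymer p)`) are VERBATIM; the chart carriers may depend on `ε₀`.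
[cite: Balaban1985UV3, (25) p.262, (28)-(30) p.263, (33)-(34) p.264, (43)-(47) pp.266-267; King1986, Thm 3.4 (3.9) p.656, Prop. 3.6 (3.56) p.662] -/
def K1aChartRowsOnChi (L : ℕ) (μ : ℝ) (𝔠 : AlphaConsts L (suGroupModel 2).N) (a₀ a₁ a : ℝ) : Prop :=
  ∃ (κ C C_E C_R C_s C_B γB : ℝ), 0 < κ ∧ κ ≤ 𝔠.κ ∧ kappa₀ (4 * 2 ^ 3) (2 * 3) ≤ κ ∧ 0 ≤ C ∧ 0 ≤ C_E ∧ 0 ≤ C_R ∧ 0 ≤ C_s ∧ 0 ≤ C_B ∧ 0 < γB ∧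
    L ≤ 𝔠.M₁ ∧
    ∀ (F : T3Family) (γ : ℝ) (hF : F.L = L) (hγ : 0 < γ), γ ≤ γB → ∀ (hγ1 : γ ≤ (min (hF ▸ 𝔠).gamma0 1) ^ 2),
      AlphaInputsT3AC.OfV3At F (hF ▸ 𝔠) a₀ a₁ →
        ∃ (p : ∀ K, AlphaInputsT3AC.PkgAtV3 F (hF ▸ 𝔠) γ hγ hγ1 K), (∀ K, (p K).a₀ = a₀ ∧ (p K).a₁ = a₁) ∧
          ∀ ε₀ : ℝ, 0 < ε₀ → ε₀ ≤ a₀ →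
          ∃ (Φ : ChartFam ↥(lieC (suGroupModel 2)) F) (e : VacFam F) (B : CfgFam ↥(lieC (suGroupModel 2)) F) (R : RemFam F),
            TaylorSplitΦ (canonPT p) Φ e B R ∧ FlatKernelCauchyΦ (AlphaInputsT3AC.dataOfV3 p (canonPolymer p)) Φ κ a C ∧
            KernelSizeΦ (AlphaInputsT3AC.dataOfV3 p (canonPolymer p)) Φ κ C_E ∧
            RemainderSmallΦOn (fun K n h V => PrintChi.ChiGood F γ (hF ▸ 𝔠).b₀ (hF ▸ 𝔠).p₀ ε₀ μ (n := n) (K := K) h V)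
              (AlphaInputsT3AC.dataOfV3 p (canonPolymer p)) R (hF ▸ 𝔠).b₀ (hF ▸ 𝔠).p₀ κ C_R ∧
            CfgSizeΦOn (fun K n h V => PrintChi.ChiGood F γ (hF ▸ 𝔠).b₀ (hF ▸ 𝔠).p₀ ε₀ μ (n := n) (K := K) h V)
              (AlphaInputsT3AC.dataOfV3 p (canonPolymer p)) B (hF ▸ 𝔠).b₀ (hF ▸ 𝔠).p₀ C_s ∧
            CfgCauchyΦOn (fun K n h V => PrintChi.ChiGood F γ (hF ▸ 𝔠).b₀ (hF ▸ 𝔠).p₀ ε₀ μ (n := n) (K := K) h V)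
              (AlphaInputsT3AC.dataOfV3 p (canonPolymer p)) B (hF ▸ 𝔠).b₀ (hF ▸ 𝔠).p₀ a C_B fun _ => 1

/-- **THE FULL-WINDOW ROWS GIVE THE χ-ROWS AT EVERY MARGIN** (`…On_of_full`; the carriers do not depend on `ε₀`). [cite: Balaban1985UV3, (47) p.267] -/
theorem k1aChartRowsOnChi_of_chartRows {L : ℕ} (μ : ℝ) {𝔠 : AlphaConsts L (suGroupModel 2).N} {a₀ a₁ a : ℝ} (h : K1aChartRows L 𝔠 a₀ a₁ a) :
    K1aChartRowsOnChi L μ 𝔠 a₀ a₁ a := by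
  obtain ⟨κ, C, C_E, C_R, C_s, C_B, γB, hκ0, hκle, hκ₀, hC, hCE, hCR, hCs, hCB, hγB, hM, hall⟩ := h
  refine ⟨κ, C, C_E, C_R, C_s, C_B, γB, hκ0, hκle, hκ₀, hC, hCE, hCR, hCs, hCB, hγB, hM, fun F γ hF hγ hγle hγ1 hOf => ?_⟩
  obtain ⟨p, hp, Φ, e, B, R, hT, hK, hE, hR, hS, hBC⟩ := hall F γ hF hγ hγle hγ1 hOf
  exact ⟨p, hp, fun ε₀ _ _ => ⟨Φ, e, B, R, hT, hK, hE, remainderSmallΦOn_of_full _ hR, cfgSizeΦOn_of_full _ hS, cfgCauchyΦOn_of_full _ hBC⟩⟩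

/-! ## §2 The registered stub (i)* from the χ-rows, by name -/

/-- **ONE BLOCK SIZE, ONE MARGIN**: if at block size `L` and margin `μ` every constants record with [7]-constants has a rate exponent `0 < a < 1` with
`K1aChartRowsOnChi L μ 𝔠 a₀ a₁ a`, then the (i)*-clause AT `(L, μ)` holds (the `hIμ` of ★r1 g0's `InteriorExcision.innerBodyAt_of_laneRecords_slackOnChi`, p538550):
threshold `γB ⊓ gammaW L 𝔠 C_s C_B ⊓ e^{2(1−p₀)}`, `π := canonPolymer p`, `σ := 7`, and the `ε₀`-UNIFORM constant `max(C′,0)·(C_T + C₁/(1 − L^{a−1}) + C₁/(1 − L⁻¹))`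
(`C′ = max 1 K₀(32,6)`, `C_T = max newConst (oldConst·L⁴)`, `C₁ = 5(C_s²C + 6C_sC_BC_E) + 2C_R`; the producer's constant does not read χ); for each `ε₀` the χ-rows feed
`GlobalSlackLocalToGlobalOn.globalSupRateWSlackOn_of_charts` over lane A's five canonical producer theorems and the three coupling windows from `γ` small.  No condition on
`L` or `μ` is used. [cite: Balaban1985UV3, (7) p.257, (43)-(47) pp.266-267, (57) p.270; King1986, Thm 3.4 (3.9) p.656, Prop. 3.6 p.662] -/
theorem slackOnChiAt_of_k1aChartRowsOnChi (L : ℕ) (μ : ℝ)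
    (h : ∀ (𝔠 : AlphaConsts L (suGroupModel 2).N) (a₀ a₁ : ℝ),
      0 < a₀ → 0 < a₁ → 𝔠.B₃ * a₁ ≤ a₀ → ∃ a : ℝ, 0 < a ∧ a < 1 ∧ K1aChartRowsOnChi L μ 𝔠 a₀ a₁ a) :
    ∀ (𝔠 : Summit.QuantumFields.Balaban3D.Proofs.Primitives.AlphaConsts L (Summit.QuantumFields.Balaban3D.Carriers.suGroupModel 2).N)
      (a₀ a₁ : ℝ), 0 < a₀ → 0 < a₁ → 𝔠.B₃ * a₁ ≤ a₀ →
      ∃ a : ℝ, 0 < a ∧ ∃ γB : ℝ, 0 < γB ∧ ∀ (F : T3Family) (γ : ℝ) (hF : F.L = L) (hγ : 0 < γ), γ ≤ γB →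
        ∀ (hγ1 : γ ≤ (min (hF ▸ 𝔠).gamma0 1) ^ 2),
          Summit.QuantumFields.YangMills.Theorems.AlphaInputsT3AC.OfV3At F (hF ▸ 𝔠) a₀ a₁ →
          ∃ (p : ∀ K, Summit.QuantumFields.YangMills.Theorems.AlphaInputsT3AC.PkgAtV3 F (hF ▸ 𝔠) γ hγ hγ1 K),
            (∀ K, (p K).a₀ = a₀ ∧ (p K).a₁ = a₁) ∧
            ∃ (π : Summit.QuantumFields.YangMills.Theorems.AlphaInputsT3AC.PolymerT3 F) (σ : ℕ) (C : ℝ), 7 ≤ σ ∧ 0 ≤ C ∧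
              ∀ ε₀ : ℝ, 0 < ε₀ → ε₀ ≤ a₀ →
                Summit.QuantumFields.YangMills.Theorems.PrintChi.GlobalSupRateTSlackOn
                  (fun K n h V => Summit.QuantumFields.YangMills.Theorems.PrintChi.ChiGood F γ (hF ▸ 𝔠).b₀ (hF ▸ 𝔠).p₀ ε₀ μ (n := n) (K := K) h V)
                  (Summit.QuantumFields.YangMills.Theorems.AlphaInputsT3AC.dataOfV3 p π) (hF ▸ 𝔠).b₀ (hF ▸ 𝔠).p₀ a σ C := by
  intro 𝔠 a₀ a₁ ha0 ha1 hw
  obtain ⟨a, ha, ha1', κ, C, C_E, C_R, C_s, C_B, γB, hκ0, hκle, hκ₀, hC, hCE, hCR, hCs, hCB, hγB, hM, hall⟩ := h 𝔠 a₀ a₁ ha0 ha1 hw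
  refine ⟨a, ha, min γB (min (gammaW L 𝔠 C_s C_B) (Real.exp (2 * (1 - 𝔠.p₀)))),
    lt_min hγB (lt_min (gammaW_pos L 𝔠 C_s C_B) (Real.exp_pos _)), fun F γ hF hγ hγle hγ1 hOf => ?_⟩
  subst hF
  have hγB' : γ ≤ γB := hγle.trans (min_le_left _ _)
  have hW : γ ≤ gammaW F.L 𝔠 C_s C_B := hγle.trans ((min_le_right _ _).trans (min_le_left _ _))
  have hγe : Real.sqrt γ ≤ Real.exp (1 - 𝔠.p₀) :=
    sqrt_le_exp_of_le (hγle.trans ((min_le_right _ _).trans (min_le_right _ _)))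
  have h0 : γ ≤ gammaθ 𝔠.b₀ 𝔠.p₀ (1 / max 1 (C_s + C_B)) := hW.trans (min_le_left _ _)
  have h1 : γ ≤ gammaθ 𝔠.b₀ (𝔠.p₀ + 𝔠.r₀) (𝔠.ρ / (4 * max 1 𝔠.cB)) := hW.trans ((min_le_right _ _).trans (min_le_left _ _))
  have h2 : γ ≤ gammaθ 𝔠.b₀ 𝔠.p₀ (1 / (2 * (8 * ((F.L : ℝ) + 1) ^ 2 * 𝔠.B₃ * 𝔠.Zfull))) := hW.trans ((min_le_right _ _).trans (min_le_right _ _))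
  have hγ1' : γ ≤ 1 := hγ1.trans (sq_min_one_le _ 𝔠.gamma0_pos)
  have hwin : ∀ n, (C_s + C_B) * θBal F.L γ 𝔠.b₀ 𝔠.p₀ n ≤ 1 := fun n => window_sum_le_one F.hL.2.le 𝔠.b₀_pos 𝔠.p₀_pos hγ hγ1' h0 n
  obtain ⟨p, hp, hrows⟩ := hall F γ rfl hγ hγB' hγ1 hOf
  have hw1 := fun K k hk => window_jet (hγ := hγ) (hγ1 := hγ1) h1 K k hk
  have hw2 := fun K k hk => window_oldSlice (hγ := hγ) (hγ1 := hγ1) h2 K k hk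
  -- the five producer rows for the canonical polymerisation (lane A's theorems) and their constants
  have hdec := pintDecompTrivT_canon p
  have hLC := locCover_canon p hκ0.le hκ₀
  have hBV := locBlockVolume_canon p hM
  have hLM := locMatched_canon p
  have hTS := termSizeTrivT_canon p hM hκ0 hκle hw1 hw2
  have hCT : 0 ≤ max (newConst 𝔠) (oldConst 𝔠 * (F.L : ℝ) ^ 4) := le_max_of_le_left (newConst_nonneg 𝔠)
  have hC₁ : 0 ≤ 5 * (C_s ^ 2 * C + 6 * C_s * C_B * C_E) + 2 * C_R := by positivity
  refine ⟨p, hp, canonPolymer p, 7, _, le_rfl, producerConst_nonneg F (C' := max 1 (K₀ (4 * 2 ^ 3) (2 * 3))) ha1' hC₁ hCT, fun ε₀ hε hεa => ?_⟩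
  obtain ⟨Φ, e, B, R, hT, hK, hE, hR, hS, hBC⟩ := hrows ε₀ hε hεa
  exact (printChi_globalSupRateTSlackOn_iff_W _ _ _ _ _ _ _).2
    (globalSupRateWSlackOn_of_charts _ hγ hγ1' hγe 𝔠.b₀_pos 𝔠.p₀_pos.le ha ha1' hC hCE hCR hCs hCB hCT hwin
      hdec hLC hBV hLM hTS hT hK hE hR hS hBC)

/-- **THE REGISTERED STUB (i)* `stub_smallBlocksSlackOnChiAll` FROM THE SIX CHART ROWS READ ON PRINT'S χ, BY NAME.**  If for every odd `1 < L < 7`, every margin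
`μ ∈ (0,1)`, every constants record and [7]-constants there is a rate exponent `0 < a < 1` with `K1aChartRowsOnChi L μ 𝔠 a₀ a₁ a`, then the text of
`stub_smallBlocksSlackOnChiAll` (skeleton v5k of stmt-QuantumFields-20520, `Cruxes/FluctuationComparisonRegPrIntL/Lines/birth_v5k.lean`) holds VERBATIM
(`slackOnChiAt_of_k1aChartRowsOnChi` at each `(L, μ)`). [cite: Balaban1985UV3, (47) p.267, (57) p.270; King1986, Thm 3.4 (3.9) p.656, Prop. 3.6 p.662] -/
theorem smallBlocksSlackOnChiAll_of_k1aChartRowsOnChi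
    (h : ∀ (L : ℕ), Odd L → 1 < L → L < 7 → ∀ (μ : ℝ), 0 < μ → μ < 1 → ∀ (𝔠 : AlphaConsts L (suGroupModel 2).N) (a₀ a₁ : ℝ),
      0 < a₀ → 0 < a₁ → 𝔠.B₃ * a₁ ≤ a₀ → ∃ a : ℝ, 0 < a ∧ a < 1 ∧ K1aChartRowsOnChi L μ 𝔠 a₀ a₁ a) :
    ∀ (L : ℕ), Odd L → 1 < L → L < 7 → ∀ (μ : ℝ), 0 < μ → μ < 1 →
      ∀ (𝔠 : Summit.QuantumFields.Balaban3D.Proofs.Primitives.AlphaConsts L (Summit.QuantumFields.Balaban3D.Carriers.suGroupModel 2).N)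
        (a₀ a₁ : ℝ), 0 < a₀ → 0 < a₁ → 𝔠.B₃ * a₁ ≤ a₀ →
        ∃ a : ℝ, 0 < a ∧ ∃ γB : ℝ, 0 < γB ∧ ∀ (F : T3Family) (γ : ℝ) (hF : F.L = L) (hγ : 0 < γ), γ ≤ γB →
          ∀ (hγ1 : γ ≤ (min (hF ▸ 𝔠).gamma0 1) ^ 2),
            Summit.QuantumFields.YangMills.Theorems.AlphaInputsT3AC.OfV3At F (hF ▸ 𝔠) a₀ a₁ →
            ∃ (p : ∀ K, Summit.QuantumFields.YangMills.Theorems.AlphaInputsT3AC.PkgAtV3 F (hF ▸ 𝔠) γ hγ hγ1 K),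
              (∀ K, (p K).a₀ = a₀ ∧ (p K).a₁ = a₁) ∧
              ∃ (π : Summit.QuantumFields.YangMills.Theorems.AlphaInputsT3AC.PolymerT3 F) (σ : ℕ) (C : ℝ), 7 ≤ σ ∧ 0 ≤ C ∧
                ∀ ε₀ : ℝ, 0 < ε₀ → ε₀ ≤ a₀ →
                  Summit.QuantumFields.YangMills.Theorems.PrintChi.GlobalSupRateTSlackOn
                    (fun K n h V => Summit.QuantumFields.YangMills.Theorems.PrintChi.ChiGood F γ (hF ▸ 𝔠).b₀ (hF ▸ 𝔠).p₀ ε₀ μ (n := n) (K := K) h V)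
                    (Summit.QuantumFields.YangMills.Theorems.AlphaInputsT3AC.dataOfV3 p π) (hF ▸ 𝔠).b₀ (hF ▸ 𝔠).p₀ a σ C :=
  fun L hLo hL1 hL7 μ hμ0 hμ1 => slackOnChiAt_of_k1aChartRowsOnChi L μ (h L hLo hL1 hL7 μ hμ0 hμ1)

/-! ## §3 The corollary from the full-window rows -/

/-- **(i)* FROM LANE A'S FULL-WINDOW ROWS AT `L ∈ {3,5}`** (the «if 3⁗'s producer runs at every block size» reading): if for every odd `1 < L < 7`, every constants record and
[7]-constants there is `0 < a < 1` with the FULL-window `K1aChartRows L 𝔠 a₀ a₁ a`, then `stub_smallBlocksSlackOnChiAll` holds at every margin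
(`k1aChartRowsOnChi_of_chartRows`).  Recorded for honesty: the window edge band (FINDING #44/#56) is why the full-window configuration rows are NOT expected at `L ∈ {3,5}`;
the χ-rows of §1 are the (R1) line's content. [cite: Balaban1985UV3, (47) p.267; King1986, Thm 3.4 (3.9) p.656] -/
theorem smallBlocksSlackOnChiAll_of_k1aChartRows
    (h : ∀ (L : ℕ), Odd L → 1 < L → L < 7 → ∀ (𝔠 : AlphaConsts L (suGroupModel 2).N) (a₀ a₁ : ℝ),
      0 < a₀ → 0 < a₁ → 𝔠.B₃ * a₁ ≤ a₀ → ∃ a : ℝ, 0 < a ∧ a < 1 ∧ K1aChartRows L 𝔠 a₀ a₁ a) :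
    ∀ (L : ℕ), Odd L → 1 < L → L < 7 → ∀ (μ : ℝ), 0 < μ → μ < 1 →
      ∀ (𝔠 : Summit.QuantumFields.Balaban3D.Proofs.Primitives.AlphaConsts L (Summit.QuantumFields.Balaban3D.Carriers.suGroupModel 2).N)
        (a₀ a₁ : ℝ), 0 < a₀ → 0 < a₁ → 𝔠.B₃ * a₁ ≤ a₀ →
        ∃ a : ℝ, 0 < a ∧ ∃ γB : ℝ, 0 < γB ∧ ∀ (F : T3Family) (γ : ℝ) (hF : F.L = L) (hγ : 0 < γ), γ ≤ γB →
          ∀ (hγ1 : γ ≤ (min (hF ▸ 𝔠).gamma0 1) ^ 2),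
            Summit.QuantumFields.YangMills.Theorems.AlphaInputsT3AC.OfV3At F (hF ▸ 𝔠) a₀ a₁ →
            ∃ (p : ∀ K, Summit.QuantumFields.YangMills.Theorems.AlphaInputsT3AC.PkgAtV3 F (hF ▸ 𝔠) γ hγ hγ1 K),
              (∀ K, (p K).a₀ = a₀ ∧ (p K).a₁ = a₁) ∧
              ∃ (π : Summit.QuantumFields.YangMills.Theorems.AlphaInputsT3AC.PolymerT3 F) (σ : ℕ) (C : ℝ), 7 ≤ σ ∧ 0 ≤ C ∧
                ∀ ε₀ : ℝ, 0 < ε₀ → ε₀ ≤ a₀ →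
                  Summit.QuantumFields.YangMills.Theorems.PrintChi.GlobalSupRateTSlackOn
                    (fun K n h V => Summit.QuantumFields.YangMills.Theorems.PrintChi.ChiGood F γ (hF ▸ 𝔠).b₀ (hF ▸ 𝔠).p₀ ε₀ μ (n := n) (K := K) h V)
                    (Summit.QuantumFields.YangMills.Theorems.AlphaInputsT3AC.dataOfV3 p π) (hF ▸ 𝔠).b₀ (hF ▸ 𝔠).p₀ a σ C :=
  smallBlocksSlackOnChiAll_of_k1aChartRowsOnChi fun L hLo hL1 hL7 μ _ _ 𝔠 a₀ a₁ ha0 ha1 hw => by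
    obtain ⟨a, ha, ha1', hc⟩ := h L hLo hL1 hL7 𝔠 a₀ a₁ ha0 ha1 hw
    exact ⟨a, ha, ha1', k1aChartRowsOnChi_of_chartRows μ hc⟩

/-! ## §4 The inner body at EVERY odd block size from 2′ and the χ-rows (no `7 ≤ L` anywhere) -/

/-- **THE INNER BODY AT EVERY ODD BLOCK SIZE FROM 2′ AND THE χ-ROWS AT PRINT'S MARGIN `μ_L = 1 − 2/(L√L)`** — ★r1 g0's per-`L` inner socket
`InteriorExcision.innerBodyAt_of_laneRecords_slackOnChi` (p538550) fed by `slackOnChiAt_of_k1aChartRowsOnChi` at `(L, μ_L)`; the shape is the `hInner` of ★p2 g14's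
`InteriorExcision.regPrIntL_of_innerChi` (p539115).  `0 < μ_L < 1` for `L > 1` (`muL_pos_lt_one`). [cite: Balaban1985UV3, (41) p.266, (47) p.267; King1986, Thm 3.4 (3.9) p.656] -/
theorem innerAll_of_laneRecords_k1aChartRowsOnChi
    (h2 : ∀ L : ℕ, Odd L → 1 < L → Summit.QuantumFields.YangMills.Theorems.AlphaInputsT3ACv3Rec L)
    (hχ : ∀ (L : ℕ), Odd L → 1 < L → ∀ (μ : ℝ), 0 < μ → μ < 1 → ∀ (𝔠 : AlphaConsts L (suGroupModel 2).N) (a₀ a₁ : ℝ),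
      0 < a₀ → 0 < a₁ → 𝔠.B₃ * a₁ ≤ a₀ → ∃ a : ℝ, 0 < a ∧ a < 1 ∧ K1aChartRowsOnChi L μ 𝔠 a₀ a₁ a) :
    ∀ L : ℕ, Odd L → 1 < L → ∃ (b₁ p₁ : ℝ), ∀ (b₀ p₀ : ℝ), b₁ ≤ b₀ → p₁ ≤ p₀ → 0 < b₀ → 2 < p₀ →
      ∃ ε₁ : ℝ, 0 < ε₁ ∧ ∀ (ε₀ : ℝ), 0 < ε₀ → ε₀ ≤ ε₁ → ∃ m₀ : ℕ, ∀ (m : ℕ), m₀ ≤ m →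
        ∃ γ₁ : ℝ, 0 < γ₁ ∧ ∀ (F : T3Family) (γ : ℝ), F.L = L → 0 < γ → γ ≤ γ₁ →
          ∃ (r κ : ℕ → ℝ), Summable r ∧ (∀ K, 0 ≤ r K) ∧
            ∀ K, ∀ᵐ V ∂fieldMeasure (F.P (K / m)) 0 (Matrix.specialUnitaryGroup (Fin 2) ℂ),
              PlaqSmall (θBal F.L γ b₀ p₀ (K / m)) V →
                PrintChi.ChiGood F γ b₀ p₀ ε₀ (1 - 2 / ((F.L : ℝ) * Real.sqrt F.L)) (Nat.div_le_self K m) V →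
                PrintChi.ChiGood F γ b₀ p₀ ε₀ (1 - 2 / ((F.L : ℝ) * Real.sqrt F.L))
                    ((Nat.div_le_self K m).trans (Nat.le_succ K)) V →
                0 < heightDensity F γ (Nat.div_le_self K m) (histGood F ℰp (θBal F.L γ b₀ p₀) K (K / m)) V →
                0 < heightDensity F γ ((Nat.div_le_self K m).trans (Nat.le_succ K))
                      (histGood F ℰp (θBal F.L γ b₀ p₀) (K + 1) (K / m)) V →
                  |(Real.log (heightDensity F γ ((Nat.div_le_self K m).trans (Nat.le_succ K))
                        (histGood F ℰp (θBal F.L γ b₀ p₀) (K + 1) (K / m)) V) + bgRegPr' F γ m ε₀ K V) -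
                    (Real.log (heightDensity F γ (Nat.div_le_self K m) (histGood F ℰp (θBal F.L γ b₀ p₀) K (K / m)) V) +
                      bgRegPr F γ m ε₀ K V) - κ K| ≤ r K := by
  intro L hLo hL
  obtain ⟨hμ0, hμ1⟩ := InteriorExcision.muL_pos_lt_one hL
  obtain ⟨b₁, p₁, H⟩ := InteriorExcision.innerBodyAt_of_laneRecords_slackOnChi L hLo hL (1 - 2 / ((L : ℝ) * Real.sqrt L)) (h2 L hLo hL)
    (slackOnChiAt_of_k1aChartRowsOnChi L _ (hχ L hLo hL _ hμ0 hμ1))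
  refine ⟨b₁, p₁, fun b₀ p₀ hb1 hp1 hb hp => ?_⟩
  obtain ⟨ε₁, hε₁, H1⟩ := H b₀ p₀ hb1 hp1 hb hp
  refine ⟨ε₁, hε₁, fun ε₀ h0 h1 => ?_⟩
  obtain ⟨m₀, H2⟩ := H1 ε₀ h0 h1
  refine ⟨m₀, fun m hm => ?_⟩
  obtain ⟨γ₁, hγ₁, H3⟩ := H2 m hm
  refine ⟨γ₁, hγ₁, fun F γ hF hγ hγle => ?_⟩
  have H4 := H3 F γ hF hγ hγle
  subst hF
  exact H4

end Summit.QuantumFields.YangMills.Theorems.GlobalSlackCanonicalOnChi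

end
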